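/-
Copyright: the b2b-balaban T⁴-continuum CRUX team, row NE7b leaf lineage `t4-ne7b-formalise-leaf-03` (gen 147). Project licence.
-/
import Summits.QuantumFields.BalabanUV.T4Continuum.Spine.NE7b.ConstrainedMinimiserRegular
import Summits.QuantumFields.BalabanUV.T4Continuum.Spine.NE7b.ConstrainedMinimiserRegularWindow
import Mathlib.Analysis.Analytic.Inverse
import Mathlib.Analysis.Analytic.Linear
import Mathlib.Analysis.Calculus.FDeriv.Analytic

/-!
# THE HARD STEP PRESERVES ANALYTICITY: for an action ANALYTIC at a non-degenerate fibre-critical point the branch of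
# constrained critical points is ANALYTIC at `w₀` (the analytic inverse function theorem — Mathlib's
# `OpenPartialHomeomorph.hasFPowerSeriesAt_symm` — on the augmented map of `ConstrainedMinimiserRegular`), and the
# hard-constraint value `φ w = ⨅ {V δ : D δ = w}` (convex case) ∕ its windowed twin `⨅ {V δ : δ ∈ K, D δ = w}` (convex on a
# window `K ∈ 𝓝 δ₀`) is ANALYTIC at `w₀` — print's analyticity road for the hard step (row NE7b, node U5c; TRANSFER row
# (xxiv): [B11] CMP 102 p.296 ∕ Sect. G «an analytic function of B … power series expansion» is the print-side currency,
# idea-1 T-93 (b); [folklore])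

Cell `pub-balaban`, sub-cell `t4`, spine estimate NE7b (`T4WeightBudget.RelWeightBound`; NOT PRINTED in [Bałaban 1983–89],
NOT PROVED).  Crux-route work under `Spine/NE7b/` by leaf-03 (CRUX team (2), FREEZE (0) crux-prover clause).  NOTHING of
Bałaban's is named, asserted, valued or discharged.  Imports this lineage's `ConstrainedMinimiserRegular` (CMR, p379513 ✓)
and `ConstrainedMinimiserRegularWindow` (CMRW, p379598 ✓) + Mathlib; no `def`; zero `sorry`.

WHY.  CMR ∕ CMRW type the `Cⁿ ⟹ C^{n+1}` regularity of the hard step; Bałaban's effective actions are ANALYTIC in the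
fields on the small-field domains ([B11] Prop. 3 p.289, (47)–(55); [B12] §1), and the road's letters that quote print by
shape (`AnalyticThirdDerivLetter*`, `B11Eq44COperatorTower.analyticAt_Cblockk`) live in that currency.  The same augmented
map `Φ δ = (Dδ, DV(δ)|_{ker D})` is analytic when `V` is, its derivative at `δ₀` is the isomorphism of CMR §1, and Mathlib's
analytic inverse function theorem makes the local inverse — hence the branch `σ w = Φ⁻¹(w, 0)` — analytic; the value is
`V ∘ σ` near `w₀` (CMR §2 ∕ CMRW §3), analytic by composition.  No order bookkeeping, no loss of one derivative.

WHAT IS PROVED ([folklore]; the analytic implicit ∕ inverse function theorem, e.g. Dieudonné, *Foundations of Modern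
Analysis* (10.2.4); Fiacco 1983 Thm 2.1's analytic remark):
* §1 **`exists_analyticAt_criticalBranch`** — `E`, `F` finite-dimensional, `D` onto, `V` ANALYTIC at `δ₀`, `δ₀` fibre-critical,
  `D²V(δ₀)` non-degenerate on `ker D` ⟹ `∃ σ : F → E`, `σ (Dδ₀) = δ₀`, `AnalyticAt ℝ σ (Dδ₀)`, eventually `D(σ w) = w ∧`
  `σ w` fibre-critical, and local uniqueness (every fibre-critical `δ` near `δ₀` is `σ (Dδ)`); `_of_pos` (positive on
  `ker D ∖ 0`).  Device: CMR's `finrank_eq_finrank_prod_dual` + `ker_augmented_eq_bot` BY NAME, `AnalyticAt.fderiv`,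
  `AnalyticAt.hasStrictFDerivAt`, `OpenPartialHomeomorph.hasFPowerSeriesAt_symm` with `p 1 = (curryFin1)⁻¹ Φ′`
  (`HasFPowerSeriesAt.fderiv_eq`).
* §2 **`analyticAt_constrValue`** — `V` convex on `E` and analytic at a non-degenerate fibre MINIMISER `δ₀` ⟹
  `w ↦ ⨅ δ : {δ // D δ = w}, V δ` is analytic at `Dδ₀` (`φ =ᶠ V ∘ σ` by CMR's `criticalBranch_isMinOn` ∕
  `iInf_fibre_eq_of_isMinOn`); **`analyticAt_constrValue_window`** — `V` convex ON A WINDOW `K ∈ 𝓝 δ₀` (CVW currency)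
  along any analytic branch (CMRW's `branch_isMinOn_window` ∕ `iInf_windowFibre_eq_of_isMinOn`); `analyticAt_constrValue_window_of_pos`
  — §1 and §2 composed, no displayed branch letter left.
* §3 toy (`example`): `D = id` on `ℝ`: `φ = V` analytic.

NOT HERE (honest): real-analytic only as Mathlib's `AnalyticAt ℝ` (power series in the real Banach sense — the right
currency for [B11]'s «power series in B»; complex-analytic extensions, radii and Cauchy bounds are the `AnalyticThirdDeriv*`
files' business); nonlinear constraints (CMRN, INTENT-4 — the same upgrade applies to the Lagrange map, not typed here);
infinite dimension; which `V, D, K` are Bałaban's ((A3) ∕ (A1c), NC-NE7b-α UNRULED).  BY-NAME EFFECT ON THE WALL: NONE.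
NE7b NOT PRINTED ∕ NOT PROVED; spine PROVED 0∕9; rung (B)+1 on a FINITE torus — NOT infinite volume, NOT the mass gap, NOT
Clay.  HONEST DEPENDENCY: continuum YM on T⁴ ⇐ BetaPertH ∧ nine spine estimates (0/9 proved); BetaPertH ⇐ (D1) ∧ (D4) ∧
CAP+tail; G-an2-4 gates asym, D1 and NE2∕3∕4.
-/

set_option autoImplicit false

noncomputable section

namespace Summit.QuantumFields.BalabanUV.T4Continuum.NE7b.ConstrainedMinimiserAnalytic

open Set Filter Topology Function
open Summit.QuantumFields.BalabanUV.T4Continuum.NE7b.ConstrainedMinimiserRegular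
open Summit.QuantumFields.BalabanUV.T4Continuum.NE7b.ConstrainedMinimiserRegularWindow

variable {E F : Type*} [NormedAddCommGroup E] [NormedSpace ℝ E] [NormedAddCommGroup F] [NormedSpace ℝ F]

/-! ## §1. The analytic branch of constrained critical points -/

section Branch

variable [FiniteDimensional ℝ E] [FiniteDimensional ℝ F]

/-- **THE ANALYTIC BRANCH OF CONSTRAINED CRITICAL POINTS.**  `E`, `F` finite-dimensional, `D : E →L[ℝ] F` onto, `V`
ANALYTIC at `δ₀`, `δ₀` fibre-critical (`DV(δ₀)` kills `ker D`), `D²V(δ₀)` non-degenerate on `ker D`.  Then there is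
`σ : F → E` with `σ (Dδ₀) = δ₀`, `AnalyticAt ℝ σ (Dδ₀)`, EVENTUALLY in `w`: `D(σ w) = w` and `σ w` fibre-critical; and
EVENTUALLY in `δ`: fibre-critical `δ ⇒ σ (Dδ) = δ`. [folklore] -/
theorem exists_analyticAt_criticalBranch {V : E → ℝ} {D : E →L[ℝ] F} (hD : Surjective D) {δ₀ : E}
    (hV : AnalyticAt ℝ V δ₀) (hcrit : ∀ k ∈ D.ker, fderiv ℝ V δ₀ k = 0)
    (hnd : ∀ k ∈ D.ker, (∀ k' ∈ D.ker, fderiv ℝ (fderiv ℝ V) δ₀ k k' = 0) → k = 0) :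
    ∃ σ : F → E, σ (D δ₀) = δ₀ ∧ AnalyticAt ℝ σ (D δ₀) ∧
      (∀ᶠ w in 𝓝 (D δ₀), D (σ w) = w ∧ ∀ k ∈ D.ker, fderiv ℝ V (σ w) k = 0) ∧
      (∀ᶠ δ in 𝓝 δ₀, (∀ k ∈ D.ker, fderiv ℝ V δ k = 0) → σ (D δ) = δ) := by
  haveI : CompleteSpace E := FiniteDimensional.complete ℝ E
  haveI : CompleteSpace (F × (D.ker →L[ℝ] ℝ)) := FiniteDimensional.complete ℝ _
  -- the augmented map (CMR §1) and its analyticity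
  set K := D.ker with hK
  set R := (ContinuousLinearMap.compL ℝ K E ℝ).flip K.subtypeL with hR
  set Φ : E → F × (K →L[ℝ] ℝ) := fun δ => (D δ, R (fderiv ℝ V δ)) with hΦ
  set Φ' := D.prod (R.comp (fderiv ℝ (fderiv ℝ V) δ₀)) with hΦ'
  have hR0 : ∀ δ : E, (∀ k ∈ K, fderiv ℝ V δ k = 0) → R (fderiv ℝ V δ) = 0 := fun δ hδ => by
    ext ⟨k, hk⟩
    simpa [hR] using hδ k hk
  have hR0' : ∀ δ : E, R (fderiv ℝ V δ) = 0 → ∀ k ∈ K, fderiv ℝ V δ k = 0 := fun δ hδ k hk => by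
    have h3 := congrArg (fun L : K →L[ℝ] ℝ => L ⟨k, hk⟩) hδ
    simpa [hR] using h3
  have hΦδ₀ : Φ δ₀ = (D δ₀, 0) := by
    simp only [hΦ, hR0 δ₀ hcrit]
  have hdVan : AnalyticAt ℝ (fderiv ℝ V) δ₀ := hV.fderiv
  have hΦan : AnalyticAt ℝ Φ δ₀ := (D.analyticAt δ₀).prod ((R.analyticAt _).comp hdVan)
  have hΦd : HasFDerivAt Φ Φ' δ₀ :=
    D.hasFDerivAt.prodMk (R.hasFDerivAt.comp δ₀ hdVan.differentiableAt.hasFDerivAt)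
  -- the derivative is an isomorphism (CMR §1's two lemmas, by name)
  have hinj : Φ'.ker = ⊥ := ker_augmented_eq_bot D (fderiv ℝ (fderiv ℝ V) δ₀) hnd
  have hsurj : Φ'.range = ⊤ :=
    LinearMap.range_eq_top.mpr
      ((LinearMap.injective_iff_surjective_of_finrank_eq_finrank (finrank_eq_finrank_prod_dual D hD)).mp
        (LinearMap.ker_eq_bot.mp hinj))
  set Φe : E ≃L[ℝ] F × (K →L[ℝ] ℝ) := ContinuousLinearEquiv.ofBijective Φ' hinj hsurj with hΦe
  have hfd : fderiv ℝ Φ δ₀ = (Φe : E →L[ℝ] F × (K →L[ℝ] ℝ)) := by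
    rw [hΦd.fderiv, hΦe, ContinuousLinearEquiv.coe_ofBijective]
  have hstrict : HasStrictFDerivAt Φ (Φe : E →L[ℝ] F × (K →L[ℝ] ℝ)) δ₀ := by
    rw [← hfd]; exact hΦan.hasStrictFDerivAt
  -- the analytic inverse function theorem
  set P := hstrict.toOpenPartialHomeomorph Φ with hP
  have hsrc : δ₀ ∈ P.source := hstrict.mem_toOpenPartialHomeomorph_source
  obtain ⟨p, hp⟩ := hΦan
  have hp1 : p 1 = (continuousMultilinearCurryFin1 ℝ E (F × (K →L[ℝ] ℝ))).symm Φe := by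
    have h := hp.fderiv_eq
    rw [hfd] at h
    rw [h]
    exact ((continuousMultilinearCurryFin1 ℝ E (F × (K →L[ℝ] ℝ))).symm_apply_apply (p 1)).symm
  have hPser : HasFPowerSeriesAt (P.symm) (p.leftInv Φe δ₀) (Φ δ₀) := P.hasFPowerSeriesAt_symm hsrc hp hp1
  set Ψ : F × (K →L[ℝ] ℝ) → E := hstrict.localInverse Φ _ δ₀ with hΨ
  have hΨP : Ψ = P.symm := rfl
  have hΨan : AnalyticAt ℝ Ψ (Φ δ₀) := by rw [hΨP]; exact hPser.analyticAt
  have hΨ0 : Ψ (Φ δ₀) = δ₀ := hstrict.localInverse_apply_image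
  have hleft : ∀ᶠ δ in 𝓝 δ₀, Ψ (Φ δ) = δ := hstrict.eventually_left_inverse
  have hright : ∀ᶠ y in 𝓝 (Φ δ₀), Φ (Ψ y) = y := hstrict.eventually_right_inverse
  -- the branch
  have hj : Continuous fun w : F => ((w, (0 : K →L[ℝ] ℝ)) : F × (K →L[ℝ] ℝ)) := continuous_id.prodMk continuous_const
  have hjan : AnalyticAt ℝ (fun w : F => ((w, (0 : K →L[ℝ] ℝ)) : F × (K →L[ℝ] ℝ))) (D δ₀) :=
    (ContinuousLinearMap.inl ℝ F (K →L[ℝ] ℝ)).analyticAt (D δ₀) |>.congr (Eventually.of_forall fun w => by simp)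
  refine ⟨fun w => Ψ (w, 0), ?_, ?_, ?_, ?_⟩
  · show Ψ (D δ₀, 0) = δ₀
    rw [← hΦδ₀]; exact hΨ0
  · have h1 : AnalyticAt ℝ Ψ (D δ₀, (0 : K →L[ℝ] ℝ)) := by rw [← hΦδ₀]; exact hΨan
    exact AnalyticAt.comp (g := Ψ) (f := fun w : F => ((w, (0 : K →L[ℝ] ℝ)) : F × (K →L[ℝ] ℝ))) h1 hjan
  · have ht : Tendsto (fun w : F => ((w, (0 : K →L[ℝ] ℝ)) : F × (K →L[ℝ] ℝ))) (𝓝 (D δ₀)) (𝓝 (Φ δ₀)) := by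
      rw [hΦδ₀]; exact hj.continuousAt
    filter_upwards [ht.eventually hright] with w hw
    have h1 : D (Ψ (w, 0)) = w := congrArg Prod.fst hw
    have h2 : R (fderiv ℝ V (Ψ (w, 0))) = 0 := congrArg Prod.snd hw
    exact ⟨h1, hR0' _ h2⟩
  · filter_upwards [hleft] with δ hδ hc
    have : Φ δ = (D δ, 0) := by simp only [hΦ, hR0 δ hc]
    rw [← this]; exact hδ

/-- The POSITIVE-DEFINITE case. [folklore] -/
theorem exists_analyticAt_criticalBranch_of_pos {V : E → ℝ} {D : E →L[ℝ] F} (hD : Surjective D) {δ₀ : E}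
    (hV : AnalyticAt ℝ V δ₀) (hcrit : ∀ k ∈ D.ker, fderiv ℝ V δ₀ k = 0)
    (hpos : ∀ k ∈ D.ker, k ≠ 0 → 0 < fderiv ℝ (fderiv ℝ V) δ₀ k k) :
    ∃ σ : F → E, σ (D δ₀) = δ₀ ∧ AnalyticAt ℝ σ (D δ₀) ∧
      (∀ᶠ w in 𝓝 (D δ₀), D (σ w) = w ∧ ∀ k ∈ D.ker, fderiv ℝ V (σ w) k = 0) ∧
      (∀ᶠ δ in 𝓝 δ₀, (∀ k ∈ D.ker, fderiv ℝ V δ k = 0) → σ (D δ) = δ) :=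
  exists_analyticAt_criticalBranch hD hV hcrit fun k hk hk0 => by
    by_contra hne
    exact (hpos k hk hne).ne' (hk0 k hk)

/-! ## §2. The value function is analytic -/

/-- **THE HARD-CONSTRAINT VALUE OF A CONVEX ANALYTIC ACTION IS ANALYTIC AT A NON-DEGENERATE MINIMISER** (finite dimension;
`V` convex on `E`, analytic at `δ₀`; `D` onto; `δ₀` a fibre minimiser over `Dδ₀`; `D²V(δ₀)` positive on `ker D ∖ 0`):
`AnalyticAt ℝ (fun w => ⨅ δ : {δ // D δ = w}, V δ) (Dδ₀)` — `φ = V ∘ σ` near `Dδ₀` along the analytic branch. [folklore] -/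
theorem analyticAt_constrValue {V : E → ℝ} (hVc : ConvexOn ℝ univ V) {D : E →L[ℝ] F} (hD : Surjective D) {δ₀ : E}
    (hV : AnalyticAt ℝ V δ₀) (hmin : IsMinOn V {δ | D δ = D δ₀} δ₀)
    (hpos : ∀ k ∈ D.ker, k ≠ 0 → 0 < fderiv ℝ (fderiv ℝ V) δ₀ k k) :
    AnalyticAt ℝ (fun w => ⨅ δ : {δ // D δ = w}, V δ.1) (D δ₀) := by
  -- Fermat on the fibre: criticality of the minimiser
  have hVd₀ : DifferentiableAt ℝ V δ₀ := hV.differentiableAt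
  have hcrit : ∀ k ∈ D.ker, fderiv ℝ V δ₀ k = 0 := by
    intro k hk
    have hline : ∀ t : ℝ, δ₀ + t • k ∈ {δ | D δ = D δ₀} := fun t => by
      simp only [mem_setOf_eq, map_add, map_smul, show D k = 0 from hk, smul_zero, add_zero]
    have hg : HasDerivAt (fun t : ℝ => V (δ₀ + t • k)) (fderiv ℝ V δ₀ k) 0 := by
      have hl : HasDerivAt (fun t : ℝ => δ₀ + t • k) k 0 := by
        simpa using ((hasDerivAt_id (0 : ℝ)).smul_const k).const_add δ₀
      have hd' : HasFDerivAt V (fderiv ℝ V δ₀) (δ₀ + (0 : ℝ) • k) := by simpa using hVd₀.hasFDerivAt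
      exact hd'.comp_hasDerivAt 0 hl
    have hlocal : IsLocalMin (fun t : ℝ => V (δ₀ + t • k)) 0 :=
      Filter.Eventually.of_forall fun t => by simpa using hmin (hline t)
    exact IsLocalMin.hasDerivAt_eq_zero hlocal hg
  obtain ⟨σ, hσ0, hσan, hbr, -⟩ := exists_analyticAt_criticalBranch_of_pos hD hV hcrit hpos
  -- `V` differentiable along the branch, `φ = V ∘ σ` near `Dδ₀`
  have hσc : ContinuousAt σ (D δ₀) := hσan.continuousAt
  have hVd : ∀ᶠ w in 𝓝 (D δ₀), DifferentiableAt ℝ V (σ w) := by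
    have h1 : ∀ᶠ δ in 𝓝 δ₀, AnalyticAt ℝ V δ := hV.eventually_analyticAt
    rw [← hσ0] at h1
    exact (hσc.eventually h1).mono fun w hw => hw.differentiableAt
  have hev : ∀ᶠ w in 𝓝 (D δ₀), (⨅ δ : {δ // D δ = w}, V δ.1) = V (σ w) := by
    filter_upwards [hbr, hVd] with w hw hVw
    exact iInf_fibre_eq_of_isMinOn D hw.1 (criticalBranch_isMinOn hVc D hw.1 hVw hw.2)
  have hcomp : AnalyticAt ℝ (V ∘ σ) (D δ₀) := by
    have h1 : AnalyticAt ℝ V (σ (D δ₀)) := by rw [hσ0]; exact hV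
    exact h1.comp hσan
  exact hcomp.congr (hev.mono fun w hw => by simpa [Function.comp] using hw.symm)

omit [FiniteDimensional ℝ E] [FiniteDimensional ℝ F] in
/-- **WINDOWED: THE VALUE OF AN ACTION CONVEX ON A WINDOW IS ANALYTIC ALONG AN ANALYTIC BRANCH** (CVW ∕ CVWS currency):
`K ∈ 𝓝 δ₀`, `V` convex on `K` and analytic at `δ₀`, a branch `σ` with `σ (Dδ₀) = δ₀`, `AnalyticAt ℝ σ (Dδ₀)`, eventually
`D(σ w) = w ∧ DV(σ w)|_{ker D} = 0` (§1 delivers it) ⟹ `AnalyticAt ℝ (fun w => ⨅ δ : {δ // δ ∈ K ∧ D δ = w}, V δ) (Dδ₀)`.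
[folklore] -/
theorem analyticAt_constrValue_window {V : E → ℝ} {K : Set E} (hVc : ConvexOn ℝ K V) {δ₀ : E} (hK : K ∈ 𝓝 δ₀)
    {D : E →L[ℝ] F} (hV : AnalyticAt ℝ V δ₀) {σ : F → E} (hσ0 : σ (D δ₀) = δ₀) (hσan : AnalyticAt ℝ σ (D δ₀))
    (hbr : ∀ᶠ w in 𝓝 (D δ₀), D (σ w) = w ∧ ∀ k ∈ D.ker, fderiv ℝ V (σ w) k = 0) :
    AnalyticAt ℝ (fun w => ⨅ δ : {δ // δ ∈ K ∧ D δ = w}, V δ.1) (D δ₀) := by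
  have hσc : ContinuousAt σ (D δ₀) := hσan.continuousAt
  have hKσ : ∀ᶠ w in 𝓝 (D δ₀), σ w ∈ K := by
    have hK' : K ∈ 𝓝 (σ (D δ₀)) := by rw [hσ0]; exact hK
    exact hσc.preimage_mem_nhds hK'
  have hVd : ∀ᶠ w in 𝓝 (D δ₀), DifferentiableAt ℝ V (σ w) := by
    have h1 : ∀ᶠ δ in 𝓝 δ₀, AnalyticAt ℝ V δ := hV.eventually_analyticAt
    rw [← hσ0] at h1
    exact (hσc.eventually h1).mono fun w hw => hw.differentiableAt
  have hev : ∀ᶠ w in 𝓝 (D δ₀), (⨅ δ : {δ // δ ∈ K ∧ D δ = w}, V δ.1) = V (σ w) := by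
    filter_upwards [hKσ, hbr, hVd] with w hKw hw hVw
    exact iInf_windowFibre_eq_of_isMinOn D hKw hw.1 (branch_isMinOn_window hVc D hKw hw.1 hVw hw.2)
  have hcomp : AnalyticAt ℝ (V ∘ σ) (D δ₀) := by
    have h1 : AnalyticAt ℝ V (σ (D δ₀)) := by rw [hσ0]; exact hV
    exact h1.comp hσan
  exact hcomp.congr (hev.mono fun w hw => by simpa [Function.comp] using hw.symm)

/-- **§1 + §2 COMPOSED (no displayed branch letter left)**: `K ∈ 𝓝 δ₀`, `V` convex on `K` and analytic at a fibre-critical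
`δ₀` with `D²V(δ₀) > 0` on `ker D ∖ 0`, `D` onto ⟹ the windowed value is analytic at `Dδ₀`. [folklore] -/
theorem analyticAt_constrValue_window_of_pos {V : E → ℝ} {K : Set E} (hVc : ConvexOn ℝ K V) {δ₀ : E} (hK : K ∈ 𝓝 δ₀)
    {D : E →L[ℝ] F} (hD : Surjective D) (hV : AnalyticAt ℝ V δ₀) (hcrit : ∀ k ∈ D.ker, fderiv ℝ V δ₀ k = 0)
    (hpos : ∀ k ∈ D.ker, k ≠ 0 → 0 < fderiv ℝ (fderiv ℝ V) δ₀ k k) :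
    AnalyticAt ℝ (fun w => ⨅ δ : {δ // δ ∈ K ∧ D δ = w}, V δ.1) (D δ₀) := by
  obtain ⟨σ, hσ0, hσan, hbr, -⟩ := exists_analyticAt_criticalBranch_of_pos hD hV hcrit hpos
  exact analyticAt_constrValue_window hVc hK hV hσ0 hσan hbr

end Branch

/-! ## §3. Toy -/

/-- Toy: `E = F = ℝ`, `D = id`: the value function is `V`, analytic where `V` is. [folklore] -/
example {V : ℝ → ℝ} (hVc : ConvexOn ℝ univ V) {x : ℝ} (hV : AnalyticAt ℝ V x) :
    AnalyticAt ℝ (fun w => ⨅ δ : {δ // (ContinuousLinearMap.id ℝ ℝ) δ = w}, V δ.1)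
      ((ContinuousLinearMap.id ℝ ℝ) x) := by
  refine analyticAt_constrValue hVc (fun w => ⟨w, rfl⟩) hV ?_ ?_
  · intro δ hδ
    simp only [ContinuousLinearMap.coe_id', id_eq, mem_setOf_eq] at hδ
    simp [hδ]
  · intro k hk hk0
    exact absurd (by simpa using hk) hk0

end Summit.QuantumFields.BalabanUV.T4Continuum.NE7b.ConstrainedMinimiserAnalytic

end
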